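import Summits.Ventures.YMGap.RobustBall.TorusRowsSU3Star
import Summits.Ventures.YMGap.RobustBall.RobustStarDoorFine
import Summits.Ventures.YMGap.Thresholds.StarSU3CertifiedRows
import HarnessLib

/-!
# Venture YMGap, track ROBUST-BALL (Y2) — `SU(3)` CERTIFIED-STAR rows: ds-2's robust vertex-star doors fed with the
# cell's CERTIFIED one-link modulus `K = 7/5` (H1 ∧ H2) — torus clustering on the whole tier-1 ball up to the radius cap

HONEST FRAMING. WHAT THIS IS: a venture file (cell `pub-ymgap`, track Y2 ROBUST-BALL, seat engine-2 (g8); 0 compute).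
Explicit STRONG-COUPLING constants for lattice `SU(3)` Yang–Mills on finite tori `(ℤ/L)^d`, `L ≥ 3` (small `β`): the robust
vertex-star door of `RobustStarDoor` / `RobustStarDoorFine` (ds-2, crux Y2-X2: any one-link Kantorovich–Rubinstein modulus
`OneLinkKRModulus N R K` ⇒ clustering of every member of the tier-1 ball `ClusterDomainFR ε₀ ε₁ r`, uniformly in `L`) fed with
the cell's CERTIFIED `SU(3)` modulus instead of p2's hypothesis-free eigen modulus of `TorusRowsSU3Star`:
`StarSU3Certified.su3_oneLinkKRModulus_sevenFifths : OneLinkPoincareSUN 3 (11/30) (4/5) → OneLinkVarianceBound 3 (11/30) (49/20) →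
OneLinkKRModulus 3 (11/30) (7/5)` (engine-2 g4; `√((4/5)(49/20)) = 7/5`), the Poincaré hypothesis being implied by the cell's
radius-`3/5` certificate H1 `OneLinkPoincareSUN 3 (3/5) (4/5)` (`poincare_elevenThirtieths_of_threeFifths`).  H1 and H2
`OneLinkVarianceBound 3 (11/30) (49/20)` are FINITE-DIMENSIONAL inequalities about ONE tilted Haar law on `SU(3)`, certified by
two independent interval-arithmetic engines each (cell records: σ2-A/B for H1; σ1-iv engines 3 and 4, 12/12 parts, for H2) and
DISPLAYED AS HYPOTHESES in every theorem below — NOT proved in this tree (class «K × C-iv»).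

CONTENT.
* §1 generic schemas for every `N ≥ 2` and ANY modulus `OneLinkKRModulus N R K` on `R ≥ 2(d−1)β_W/N²` (so a future certified
  or proved modulus for any `N` plugs in): `d = 4` torus clustering up to `β_W/N` (`suN_torusClusteringOnBallUpTo_star_of_modulus`),
  `d = 3` Y4's receiving currency `YM3IR.ClusterDomainClustering` + torus form (`suN_clusterDomainClustering_dim3_star_of_modulus`),
  `d = 4` reads-incidence (fine) ball (`suN_torusClusteringOnBallFine_star_of_modulus`) — ds-2's proofs verbatim with the eigen
  modulus replaced by a hypothesis;
* §2 the `SU(3)` schemas GIVEN H1, H2 (`K = 7/5`, `√3 ≤ 1.73206`, radius cap `6β_W/9 ≤ 11/30`, i.e. `β_W ≤ 11/20` in `d = 4` and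
  `4β_W/9 ≤ 11/30`, i.e. `β_W ≤ 33/40` in `d = 3`);
* THIS FILE HAS SCHEMAS ONLY; the NAMED ROWS `(β_W, ε)` (one-parameter ball `(ε₀, ε₁) = (2ε, ε)`, exact rationals, `e^{2ε}` by
  `Real.exp_bound'`, Neumann depth 20; certificates by exact `Fraction` arithmetic, engine-2 `cert_su3_star.py`; second lineage
  rb-theory's exact screen, 14/14 maximal on the 1/1000 grid) live in the SIBLING FILES `TorusRowsSU3StarCertifiedDim4.lean`
  (`d = 4`: (1/4, .103) (3/10, .083) (1/3, .070) (2/5, .048) (9/20, .033) (1/2, .019) (11/20, .007); fine ball (1/3, .070) (1/2, .019)),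
  `TorusRowsSU3StarCertifiedDim3.lean` (`d = 3`: (2/5, .098) (9/20, .085) (1/2, .073) (3/5, .051) (2/3, .038) (3/4, .023) (33/40, .011))
  and, on `ℤ⁴` / `ℤ³` through ds-2's `RobustStarDoorZd`, `MassGapOnBallZdGRowsSU3Certified.lean` (same cells).
WHAT MOVES (cell bookkeeping, ROBUST-BALL-STATEMENT §5): the `SU(3)` TORUS frontier GIVEN H1, H2 was `β_W = 3/10` in `d = 4`
(variance/pair single-link door, `TorusRowsSU3Variance` (3/10, .058)) and `9/20` in `d = 3` (`TorusRowsSU3YM3.su3_ym3Row_9_20`,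
(9/20, .058)); through the star door it is the RADIUS CAP of the certificates, `11/20` resp. `33/40` (the door itself would close
only at `β_W ≈ .580` resp. `.902`: at `ε = 0`, `12c² + 10c < 1` resp. `8c² + 6c < 1` with `c = (7/5)β_W/9`).  The star cells beat the
variance-door cells from `β_W ≈ .27` on and are beaten below it ((1/4, .103) vs (1/4, .116)); no row is withdrawn.  The
hypothesis-free `SU(3)` ceiling stays ds-2's ((1/4, .019) in `d = 4`, (1/3, .050) in `d = 3`, eigen modulus).
WHAT THIS IS NOT: not hypothesis-free for `SU(3)` (H1/H2 displayed); radii and thresholds are door artefacts, not phase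
boundaries; one-sided clustering bounds on finite tori uniformly in the side, not a transfer-matrix spectral gap; nothing at weak
coupling, nothing about the continuum limit or the Millennium problem.

## References
* R. L. Dobrushin, S. B. Shlosman, *Constructive criterion for the uniqueness of Gibbs field* (1985); H. Föllmer, LNM 1362 (1988)
  Ch. I, Thm. (2.13) (the covariance estimate behind `√(c·v)`).
* H. Shen, R. Zhu, X. Zhu, CMP 400 (2023), arXiv:2204.12737, Lemma 4.1 / Rem. 1.3 (Bakry–Émery one-link bound; the schema H1).
* The tree: `RobustBall/RobustStarDoor.lean`, `RobustStarDoorFine.lean`, `TorusRowsSU3Star.lean` (ds-2); `Thresholds/StarSU3CertifiedRows.lean`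
  (engine-2 g4: the certified modulus); `Thresholds/StarResolventDim.lean` (`gaugeR`, `doorPoly`); `TorusRowsSU3.lean` (`sqrt_three_le`).
-/

noncomputable section

open Finset
open Literature.MathematicalPhysics.QuantumLattice (fundamentalRep)
open Literature.MathematicalPhysics.QuantumFieldTheory hiding ZdEdge
open Literature.MathematicalPhysics.QuantumFieldTheory.Balaban1983to89.StrongCouplingTorusWindow
open Literature.MathematicalPhysics.QuantumFieldTheory.Balaban1983to89.StrongCouplingDobrushinWindow
  (OneLinkKRModulus)
open Summit.QuantumFields.BalabanUV.InfraRed.StrongCouplingPoincareDoorSUN (OneLinkPoincareSUN)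
open Summit.QuantumFields.BalabanUV.InfraRed.StrongCouplingVarianceDoorSUN (OneLinkVarianceBound)
open Summit.Ventures.YMGap.StarResolventDim (Delta gaugeR doorPoly Delta_pos_of_door gaugeR_lt_one_of_door)
open Summit.Ventures.YMGap.StarSU3Certified (su3_oneLinkKRModulus_sevenFifths poincare_elevenThirtieths_of_threeFifths)

namespace Summit.Ventures.YMGap.RobustBall

/-! ### 1. Generic schemas: every `N ≥ 2`, ANY one-link modulus, through the robust star door -/

/-- **SCHEMA, `SU(N)` (`N ≥ 2`), `d = 4`, ANY MODULUS**: torus clustering on the whole tier-1 ball `ClusterDomainFR ε₀ ε₁ r`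
up to tree coupling `β_W/N` through the ROBUST STAR DOOR on a one-link modulus `OneLinkKRModulus N R K` valid at radius
`R ≥ 6β_W/N²`: given majorants `e^{ε₀} ≤ E`, `√N ≤ S`, a coefficient `c ≥ K·E·(1+2Sε₁)·β_W/N²`, `λ ≥ Sε₁` and the three
rational door inequalities (`θ = 6c + λ < 1`, `doorPoly 4 c < 1`, `gaugeR 4 c + (λ + θ^Kn·16λ)/(1−θ) < 1`), there are `A`, `m > 0`
with `TorusClusteringOnBallUpTo N 4 (β_W/N) ε₀ ε₁ r A m` — ds-2's `suN_torusClusteringOnBallUpTo_star_eigen` with the eigen modulus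
replaced by a hypothesis. [folklore] -/
theorem suN_torusClusteringOnBallUpTo_star_of_modulus (Kn : ℕ) {N : ℕ} (hN : 2 ≤ N) {βW ε₀ ε₁ c lam E S R K : ℝ}
    (hK : 0 ≤ K) (hmod : OneLinkKRModulus N R K) (hβ0 : 0 < βW) (hR : βW / (N : ℝ) ^ 2 * 6 ≤ R) (hε₁ : 0 ≤ ε₁)
    (hE : Real.exp ε₀ ≤ E) (hS : Real.sqrt N ≤ S) (hc : K * E * (1 + 2 * S * ε₁) * (βW / (N : ℝ) ^ 2) ≤ c)
    (hlam : S * ε₁ ≤ lam) (hθ1 : 6 * c + lam < 1) (hcd : doorPoly 4 c < 1)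
    (hρ1 : gaugeR 4 c + (lam + (6 * c + lam) ^ Kn * (16 * lam)) / (1 - (6 * c + lam)) < 1) (r : ℕ) :
    ∃ A m : ℝ, 0 < m ∧ TorusClusteringOnBallUpTo N 4 (βW / N) ε₀ ε₁ r A m := by
  have hN1 : 1 ≤ N := by omega
  have hNpos : (0 : ℝ) < N := by exact_mod_cast (show 0 < N by omega)
  have hS0 : 0 ≤ S := (Real.sqrt_nonneg _).trans hS
  have hE0 : 0 ≤ E := (Real.exp_pos _).le.trans hE
  have hc0 : 0 ≤ c := le_trans (by positivity) hc
  have hlam0 : 0 ≤ lam := le_trans (by positivity) hlam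
  set θ : ℝ := 6 * c + lam with hθ
  set ρ : ℝ := gaugeR 4 c + (lam + θ ^ Kn * (16 * lam)) / (1 - θ) with hρ
  have hθ0 : 0 ≤ θ := by positivity
  have hgR := gaugeR_lt_one_of_door (d := 4) (by norm_num) hc0 hcd
  have hρ0 : 0 ≤ ρ := by
    have : 0 ≤ θ ^ Kn := pow_nonneg hθ0 Kn
    have h1 : 0 < 1 - θ := by linarith
    rw [hρ]; exact add_nonneg hgR.1 (div_nonneg (by positivity) h1.le)
  have hβN : βW / (N : ℝ) / (N : ℝ) = βW / (N : ℝ) ^ 2 := by rw [div_div, sq]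
  have hR' : βW / (N : ℝ) / (N : ℝ) * (2 * (((4 : ℕ) : ℝ) - 1)) ≤ R := by
    rw [hβN]; refine le_trans (le_of_eq ?_) hR; norm_num
  have hc' : K * Real.exp ε₀ * (1 + 2 * Real.sqrt N * ε₁) * (βW / (N : ℝ) / (N : ℝ)) ≤ c := by
    refine le_trans ?_ hc
    rw [hβN]
    have hb : 0 ≤ βW / (N : ℝ) ^ 2 := by positivity
    have h2 : 1 + 2 * Real.sqrt N * ε₁ ≤ 1 + 2 * S * ε₁ := by nlinarith
    have h3 : 0 ≤ 1 + 2 * Real.sqrt N * ε₁ := by positivity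
    calc K * Real.exp ε₀ * (1 + 2 * Real.sqrt N * ε₁) * (βW / (N : ℝ) ^ 2)
        ≤ K * E * (1 + 2 * Real.sqrt N * ε₁) * (βW / (N : ℝ) ^ 2) := by gcongr
      _ ≤ K * E * (1 + 2 * S * ε₁) * (βW / (N : ℝ) ^ 2) := by gcongr
  have hlam' : Real.sqrt N * ε₁ ≤ lam := le_trans (mul_le_mul_of_nonneg_right hS hε₁) hlam
  have hθ' : θ = (2 * ((4 : ℕ) : ℝ) - 2) * c + lam := by rw [hθ]; push_cast; ring
  have hρ' : ρ = gaugeR 4 c + (lam + θ ^ Kn * (4 * ((4 : ℕ) : ℝ) * lam)) / (1 - θ) := by rw [hρ]; push_cast; ring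
  have h := torusClusteringOnBallUpTo_of_robustStar (d := 4) (N := N) (by norm_num) hN1 r Kn hK hR' hmod hε₁ hc'
    hlam' hθ' hθ1 hcd hρ' hρ1
  refine ⟨_, _, ?_, h⟩
  have h1 : 0 < 1 - ρ := by linarith
  have hden : 0 < 2 * (2 * ρ * ((2 * 4 : ℕ) : ℝ) + 1) := by push_cast; nlinarith
  positivity

/-- **SCHEMA, `SU(N)` (`N ≥ 2`), `d = 3`, ANY MODULUS**: Y4's receiving currency `YM3IR.ClusterDomainClustering` on the whole
tier-1 ball up to `β_W/N` through the ROBUST STAR DOOR on a modulus `OneLinkKRModulus N R K` valid at radius `R ≥ 4β_W/N²`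
(door `8c² + 6c < 1`, `θ = 4c + λ`), plus the torus form — ds-2's `suN_clusterDomainClustering_dim3_star_eigen` with the eigen
modulus replaced by a hypothesis. [folklore] -/
theorem suN_clusterDomainClustering_dim3_star_of_modulus (Kn : ℕ) {N : ℕ} (hN : 2 ≤ N) {βW ε₀ ε₁ c lam E S R K : ℝ}
    (hK : 0 ≤ K) (hmod : OneLinkKRModulus N R K) (hβ0 : 0 < βW) (hR : βW / (N : ℝ) ^ 2 * 4 ≤ R) (hε₁ : 0 ≤ ε₁)
    (hE : Real.exp ε₀ ≤ E) (hS : Real.sqrt N ≤ S) (hc : K * E * (1 + 2 * S * ε₁) * (βW / (N : ℝ) ^ 2) ≤ c)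
    (hlam : S * ε₁ ≤ lam) (hθ1 : 4 * c + lam < 1) (hcd : doorPoly 3 c < 1)
    (hρ1 : gaugeR 3 c + (lam + (4 * c + lam) ^ Kn * (12 * lam)) / (1 - (4 * c + lam)) < 1) (r : ℕ) :
    ∃ m : ℝ, 0 < m ∧
      YM3IR.ClusterDomainClustering (G := SUN N)
        ⟨fundamentalRep (Fin N), βW / N, fun _ _ W => W ∈ ClusterDomainFR ε₀ ε₁ r⟩ suFrobDist m ∧
      ∃ A : ℝ, TorusClusteringOnBallUpTo N 3 (βW / N) ε₀ ε₁ r A m := by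
  have hN1 : 1 ≤ N := by omega
  have hNpos : (0 : ℝ) < N := by exact_mod_cast (show 0 < N by omega)
  have hS0 : 0 ≤ S := (Real.sqrt_nonneg _).trans hS
  have hE0 : 0 ≤ E := (Real.exp_pos _).le.trans hE
  have hc0 : 0 ≤ c := le_trans (by positivity) hc
  have hlam0 : 0 ≤ lam := le_trans (by positivity) hlam
  set θ : ℝ := 4 * c + lam with hθ
  set ρ : ℝ := gaugeR 3 c + (lam + θ ^ Kn * (12 * lam)) / (1 - θ) with hρ
  have hθ0 : 0 ≤ θ := by positivity
  have hgR := gaugeR_lt_one_of_door (d := 3) (by norm_num) hc0 hcd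
  have hρ0 : 0 ≤ ρ := by
    have : 0 ≤ θ ^ Kn := pow_nonneg hθ0 Kn
    have h1 : 0 < 1 - θ := by linarith
    rw [hρ]; exact add_nonneg hgR.1 (div_nonneg (by positivity) h1.le)
  have hβN : βW / (N : ℝ) / (N : ℝ) = βW / (N : ℝ) ^ 2 := by rw [div_div, sq]
  have hR' : βW / (N : ℝ) / (N : ℝ) * 4 ≤ R := by rw [hβN]; exact hR
  have hR'' : βW / (N : ℝ) / (N : ℝ) * (2 * (((3 : ℕ) : ℝ) - 1)) ≤ R := by
    rw [hβN]; refine le_trans (le_of_eq ?_) hR; norm_num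
  have hc' : K * Real.exp ε₀ * (1 + 2 * Real.sqrt N * ε₁) * (βW / (N : ℝ) / (N : ℝ)) ≤ c := by
    refine le_trans ?_ hc
    rw [hβN]
    have hb : 0 ≤ βW / (N : ℝ) ^ 2 := by positivity
    have h2 : 1 + 2 * Real.sqrt N * ε₁ ≤ 1 + 2 * S * ε₁ := by nlinarith
    have h3 : 0 ≤ 1 + 2 * Real.sqrt N * ε₁ := by positivity
    calc K * Real.exp ε₀ * (1 + 2 * Real.sqrt N * ε₁) * (βW / (N : ℝ) ^ 2)
        ≤ K * E * (1 + 2 * Real.sqrt N * ε₁) * (βW / (N : ℝ) ^ 2) := by gcongr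
      _ ≤ K * E * (1 + 2 * S * ε₁) * (βW / (N : ℝ) ^ 2) := by gcongr
  have hlam' : Real.sqrt N * ε₁ ≤ lam := le_trans (mul_le_mul_of_nonneg_right hS hε₁) hlam
  have hθ' : θ = (2 * ((3 : ℕ) : ℝ) - 2) * c + lam := by rw [hθ]; push_cast; ring
  have hρ' : ρ = gaugeR 3 c + (lam + θ ^ Kn * (4 * ((3 : ℕ) : ℝ) * lam)) / (1 - θ) := by rw [hρ]; push_cast; ring
  have hm : 0 < (1 - ρ) ^ 2 / (2 * (2 * ρ * ((2 * 3 : ℕ) : ℝ) + 1)) / ((max r 1 + 2 : ℕ) : ℝ) := by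
    have h1 : 0 < 1 - ρ := by linarith
    have hden : 0 < 2 * (2 * ρ * ((2 * 3 : ℕ) : ℝ) + 1) := by push_cast; nlinarith
    positivity
  refine ⟨_, hm, clusterDomainClustering_dim3_of_robustStar (N := N) hN1 r Kn hK hR' hmod hε₁ hc' hlam' hθ hθ1
    hcd hρ hρ1, _, torusClusteringOnBallUpTo_of_robustStar (d := 3) (N := N) (by norm_num) hN1 r Kn hK hR'' hmod hε₁
      hc' hlam' hθ' hθ1 hcd hρ' hρ1⟩

/-- **SCHEMA, `SU(N)` (`N ≥ 2`), `d = 4`, ANY MODULUS, READS-INCIDENCE (fine) ball**: the same door on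
`ClusterDomainFRFine ε₀ ε₁ r ⊇ ClusterDomainFR ε₀ ε₁ r` AT tree coupling `β_W/N` (`TorusClusteringOnBallFine`, ds-2's
`torusClusteringOnBallFine_of_robustStar`). [folklore] -/
theorem suN_torusClusteringOnBallFine_star_of_modulus (Kn : ℕ) {N : ℕ} (hN : 2 ≤ N) {βW ε₀ ε₁ c lam E S R K : ℝ}
    (hK : 0 ≤ K) (hmod : OneLinkKRModulus N R K) (hβ0 : 0 < βW) (hR : βW / (N : ℝ) ^ 2 * 6 ≤ R) (hε₁ : 0 ≤ ε₁)
    (hE : Real.exp ε₀ ≤ E) (hS : Real.sqrt N ≤ S) (hc : K * E * (1 + 2 * S * ε₁) * (βW / (N : ℝ) ^ 2) ≤ c)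
    (hlam : S * ε₁ ≤ lam) (hθ1 : 6 * c + lam < 1) (hcd : doorPoly 4 c < 1)
    (hρ1 : gaugeR 4 c + (lam + (6 * c + lam) ^ Kn * (16 * lam)) / (1 - (6 * c + lam)) < 1) (r : ℕ) :
    ∃ A m : ℝ, 0 < m ∧ TorusClusteringOnBallFine N 4 (βW / N) ε₀ ε₁ r A m := by
  have hN1 : 1 ≤ N := by omega
  have hNpos : (0 : ℝ) < N := by exact_mod_cast (show 0 < N by omega)
  have hS0 : 0 ≤ S := (Real.sqrt_nonneg _).trans hS
  have hE0 : 0 ≤ E := (Real.exp_pos _).le.trans hE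
  have hc0 : 0 ≤ c := le_trans (by positivity) hc
  have hlam0 : 0 ≤ lam := le_trans (by positivity) hlam
  set θ : ℝ := 6 * c + lam with hθ
  set ρ : ℝ := gaugeR 4 c + (lam + θ ^ Kn * (16 * lam)) / (1 - θ) with hρ
  have hθ0 : 0 ≤ θ := by positivity
  have hgR := gaugeR_lt_one_of_door (d := 4) (by norm_num) hc0 hcd
  have hρ0 : 0 ≤ ρ := by
    have : 0 ≤ θ ^ Kn := pow_nonneg hθ0 Kn
    have h1 : 0 < 1 - θ := by linarith
    rw [hρ]; exact add_nonneg hgR.1 (div_nonneg (by positivity) h1.le)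
  have hβabs : |βW / (N : ℝ)| = βW / (N : ℝ) := abs_of_pos (by positivity)
  have hβN : βW / (N : ℝ) / (N : ℝ) = βW / (N : ℝ) ^ 2 := by rw [div_div, sq]
  have hR' : |βW / (N : ℝ)| / (N : ℝ) * (2 * (((4 : ℕ) : ℝ) - 1)) ≤ R := by
    rw [hβabs, hβN]; refine le_trans (le_of_eq ?_) hR; norm_num
  have hc' : K * Real.exp ε₀ * (1 + 2 * Real.sqrt N * ε₁) * (|βW / (N : ℝ)| / (N : ℝ)) ≤ c := by
    refine le_trans ?_ hc
    rw [hβabs, hβN]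
    have hb : 0 ≤ βW / (N : ℝ) ^ 2 := by positivity
    have h2 : 1 + 2 * Real.sqrt N * ε₁ ≤ 1 + 2 * S * ε₁ := by nlinarith
    have h3 : 0 ≤ 1 + 2 * Real.sqrt N * ε₁ := by positivity
    calc K * Real.exp ε₀ * (1 + 2 * Real.sqrt N * ε₁) * (βW / (N : ℝ) ^ 2)
        ≤ K * E * (1 + 2 * Real.sqrt N * ε₁) * (βW / (N : ℝ) ^ 2) := by gcongr
      _ ≤ K * E * (1 + 2 * S * ε₁) * (βW / (N : ℝ) ^ 2) := by gcongr
  have hlam' : Real.sqrt N * ε₁ ≤ lam := le_trans (mul_le_mul_of_nonneg_right hS hε₁) hlam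
  have hθ' : θ = (2 * ((4 : ℕ) : ℝ) - 2) * c + lam := by rw [hθ]; push_cast; ring
  have hρ' : ρ = gaugeR 4 c + (lam + θ ^ Kn * (4 * ((4 : ℕ) : ℝ) * lam)) / (1 - θ) := by rw [hρ]; push_cast; ring
  have h := torusClusteringOnBallFine_of_robustStar (d := 4) (N := N) (by norm_num) hN1 r Kn hK hR' hmod hε₁ hc'
    hlam' hθ' hθ1 hcd hρ' hρ1
  refine ⟨_, _, ?_, h⟩
  have h1 : 0 < 1 - ρ := by linarith
  have hden : 0 < 2 * (2 * ρ * ((2 * 4 : ℕ) : ℝ) + 1) := by push_cast; nlinarith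
  positivity

/-! ### 2. The `SU(3)` schemas GIVEN H1, H2: the certified modulus `K = 7/5` at radius `11/30` -/

/-- The cell's two certificates give the modulus used here: H1 `OneLinkPoincareSUN 3 (3/5) (4/5)` (monotone to radius `11/30`)
and H2 `OneLinkVarianceBound 3 (11/30) (49/20)` ⇒ `OneLinkKRModulus 3 (11/30) (7/5)` (engine-2 g4's
`StarSU3Certified.su3_oneLinkKRModulus_sevenFifths`, Föllmer's covariance estimate `√(c·v)`). [folklore] -/
theorem su3_certifiedModulus_of_pair (hP : OneLinkPoincareSUN 3 (3 / 5) (4 / 5))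
    (hV : OneLinkVarianceBound 3 (11 / 30) (49 / 20)) : OneLinkKRModulus 3 (11 / 30) (7 / 5) :=
  su3_oneLinkKRModulus_sevenFifths (poincare_elevenThirtieths_of_threeFifths hP) hV

/-- **SCHEMA, `SU(3)`, `d = 4`, GIVEN H1, H2**: for `0 < β_W ≤ 11/20` (radius `6β_W/9 ≤ 11/30`), majorant `e^{ε₀} ≤ E`, a
coefficient `c ≥ (7/5)·E·(1 + 2·1.73206·ε₁)·β_W/9`, `λ ≥ 1.73206·ε₁` and the three rational door inequalities, there are `A`,
`m > 0` with `TorusClusteringOnBallUpTo 3 4 (β_W/3) ε₀ ε₁ r A m`. [folklore] -/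
theorem su3_torusClusteringOnBallUpTo_certifiedStar (Kn : ℕ) (hP : OneLinkPoincareSUN 3 (3 / 5) (4 / 5))
    (hV : OneLinkVarianceBound 3 (11 / 30) (49 / 20)) {βW ε₀ ε₁ c lam E : ℝ} (hβ0 : 0 < βW) (hβ : βW ≤ 11 / 20)
    (hε₁ : 0 ≤ ε₁) (hE : Real.exp ε₀ ≤ E) (hc : 7 / 5 * E * (1 + 2 * 1.73206 * ε₁) * (βW / 9) ≤ c)
    (hlam : 1.73206 * ε₁ ≤ lam) (hθ1 : 6 * c + lam < 1) (hcd : doorPoly 4 c < 1)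
    (hρ1 : gaugeR 4 c + (lam + (6 * c + lam) ^ Kn * (16 * lam)) / (1 - (6 * c + lam)) < 1) (r : ℕ) :
    ∃ A m : ℝ, 0 < m ∧ TorusClusteringOnBallUpTo 3 4 (βW / 3) ε₀ ε₁ r A m := by
  have hS : Real.sqrt ((3 : ℕ) : ℝ) ≤ 1.73206 := by
    have : ((3 : ℕ) : ℝ) = 3 := by norm_num
    rw [this]; exact sqrt_three_le
  have e9 : βW / ((3 : ℕ) : ℝ) ^ 2 = βW / 9 := by norm_num
  have e3 : βW / ((3 : ℕ) : ℝ) = βW / 3 := by norm_num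
  have hR : βW / ((3 : ℕ) : ℝ) ^ 2 * 6 ≤ 11 / 30 := by rw [e9]; linarith
  have hc' : 7 / 5 * E * (1 + 2 * 1.73206 * ε₁) * (βW / ((3 : ℕ) : ℝ) ^ 2) ≤ c := by rw [e9]; exact hc
  have h := suN_torusClusteringOnBallUpTo_star_of_modulus Kn (N := 3) (by norm_num) (by norm_num)
    (su3_certifiedModulus_of_pair hP hV) hβ0 hR hε₁ hE hS hc' hlam hθ1 hcd hρ1 r
  rw [e3] at h
  exact h

/-- **SCHEMA, `SU(3)`, `d = 3`, GIVEN H1, H2**: for `0 < β_W ≤ 33/40` (radius `4β_W/9 ≤ 11/30`), majorant `e^{ε₀} ≤ E`,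
`c ≥ (7/5)·E·(1 + 2·1.73206·ε₁)·β_W/9`, `λ ≥ 1.73206·ε₁`, door `8c² + 6c < 1`, `θ = 4c + λ < 1`,
`gaugeR 3 c + (λ + θ^Kn·12λ)/(1−θ) < 1`: Y4's `YM3IR.ClusterDomainClustering` on `ClusterDomainFR ε₀ ε₁ r` up to tree coupling
`β_W/3` at some rate `m > 0`, plus the torus form. [folklore] -/
theorem su3_clusterDomainClustering_dim3_certifiedStar (Kn : ℕ) (hP : OneLinkPoincareSUN 3 (3 / 5) (4 / 5))
    (hV : OneLinkVarianceBound 3 (11 / 30) (49 / 20)) {βW ε₀ ε₁ c lam E : ℝ} (hβ0 : 0 < βW) (hβ : βW ≤ 33 / 40)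
    (hε₁ : 0 ≤ ε₁) (hE : Real.exp ε₀ ≤ E) (hc : 7 / 5 * E * (1 + 2 * 1.73206 * ε₁) * (βW / 9) ≤ c)
    (hlam : 1.73206 * ε₁ ≤ lam) (hθ1 : 4 * c + lam < 1) (hcd : doorPoly 3 c < 1)
    (hρ1 : gaugeR 3 c + (lam + (4 * c + lam) ^ Kn * (12 * lam)) / (1 - (4 * c + lam)) < 1) (r : ℕ) :
    ∃ m : ℝ, 0 < m ∧
      YM3IR.ClusterDomainClustering (G := SUN 3)
        ⟨fundamentalRep (Fin 3), βW / 3, fun _ _ W => W ∈ ClusterDomainFR ε₀ ε₁ r⟩ suFrobDist m ∧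
      ∃ A : ℝ, TorusClusteringOnBallUpTo 3 3 (βW / 3) ε₀ ε₁ r A m := by
  have hS : Real.sqrt ((3 : ℕ) : ℝ) ≤ 1.73206 := by
    have : ((3 : ℕ) : ℝ) = 3 := by norm_num
    rw [this]; exact sqrt_three_le
  have e9 : βW / ((3 : ℕ) : ℝ) ^ 2 = βW / 9 := by norm_num
  have e3 : βW / ((3 : ℕ) : ℝ) = βW / 3 := by norm_num
  have hR : βW / ((3 : ℕ) : ℝ) ^ 2 * 4 ≤ 11 / 30 := by rw [e9]; linarith
  have hc' : 7 / 5 * E * (1 + 2 * 1.73206 * ε₁) * (βW / ((3 : ℕ) : ℝ) ^ 2) ≤ c := by rw [e9]; exact hc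
  have h := suN_clusterDomainClustering_dim3_star_of_modulus Kn (N := 3) (by norm_num) (by norm_num)
    (su3_certifiedModulus_of_pair hP hV) hβ0 hR hε₁ hE hS hc' hlam hθ1 hcd hρ1 r
  rw [e3] at h
  exact h

/-- **SCHEMA, `SU(3)`, `d = 4`, GIVEN H1, H2, READS-INCIDENCE ball**: same hypotheses as
`su3_torusClusteringOnBallUpTo_certifiedStar`, conclusion `∃ A, ∃ m > 0, TorusClusteringOnBallFine 3 4 (β_W/3) ε₀ ε₁ r A m`.
[folklore] -/
theorem su3_torusClusteringOnBallFine_certifiedStar (Kn : ℕ) (hP : OneLinkPoincareSUN 3 (3 / 5) (4 / 5))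
    (hV : OneLinkVarianceBound 3 (11 / 30) (49 / 20)) {βW ε₀ ε₁ c lam E : ℝ} (hβ0 : 0 < βW) (hβ : βW ≤ 11 / 20)
    (hε₁ : 0 ≤ ε₁) (hE : Real.exp ε₀ ≤ E) (hc : 7 / 5 * E * (1 + 2 * 1.73206 * ε₁) * (βW / 9) ≤ c)
    (hlam : 1.73206 * ε₁ ≤ lam) (hθ1 : 6 * c + lam < 1) (hcd : doorPoly 4 c < 1)
    (hρ1 : gaugeR 4 c + (lam + (6 * c + lam) ^ Kn * (16 * lam)) / (1 - (6 * c + lam)) < 1) (r : ℕ) :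
    ∃ A m : ℝ, 0 < m ∧ TorusClusteringOnBallFine 3 4 (βW / 3) ε₀ ε₁ r A m := by
  have hS : Real.sqrt ((3 : ℕ) : ℝ) ≤ 1.73206 := by
    have : ((3 : ℕ) : ℝ) = 3 := by norm_num
    rw [this]; exact sqrt_three_le
  have e9 : βW / ((3 : ℕ) : ℝ) ^ 2 = βW / 9 := by norm_num
  have e3 : βW / ((3 : ℕ) : ℝ) = βW / 3 := by norm_num
  have hR : βW / ((3 : ℕ) : ℝ) ^ 2 * 6 ≤ 11 / 30 := by rw [e9]; linarith
  have hc' : 7 / 5 * E * (1 + 2 * 1.73206 * ε₁) * (βW / ((3 : ℕ) : ℝ) ^ 2) ≤ c := by rw [e9]; exact hc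
  have h := suN_torusClusteringOnBallFine_star_of_modulus Kn (N := 3) (by norm_num) (by norm_num)
    (su3_certifiedModulus_of_pair hP hV) hβ0 hR hε₁ hE hS hc' hlam hθ1 hcd hρ1 r
  rw [e3] at h
  exact h

end Summit.Ventures.YMGap.RobustBall

end
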